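import Summits.AtomisticToContinuum.Crystallization.Theorems.FreeSplittingCertificatesStrictSplittingRuleP1CellVariance

/-!
# `StrictSplittingRule` (stmt-AtomisticToContinuum-12560): the vertex-quadrature excess on a real cell with a VARIABLE positive semidefinite weight (P1 interpolant object, part 25)

Route `FreeSplittingCertificates`, crux r3 `StrictSplittingRule` (H12⋆ = `stub_coreJointCoercive`), unit b2b-freesplit-B gen 22.
VALUE = the cell-level inequality of the DEMAND side in the form the MATCHED SPLIT uses (HOME FAR-LEMMA-SPEC §17 (e)): for a weight
`x ↦ W(x)` (continuous, `0 ⪯ W(x) ⪯ w_T·I` on the cell `T`; in the assembly `W = χ²·2|x|⁻⁸x̂x̂ᵀ`, the radial bare density), vertex values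
`v₀..v₃` and the P1 combination `ṽ = Σ_m λ_m v_m`,
`Σ_m v_mᵀ(∫_T λ_m W)v_m ≤ ∫_T ṽᵀWṽ + (√3a²h/192)·w_T·½Σ_{m,m'}|v_m − v_{m'}|²`
(**`vertex_quadrature_excess_var_p1RealCell`**): the MATCHED lattice bare coefficient of a vertex (`∫φ_q W` summed over its star, cell by
cell `∫_T λ_m W`) is paid by the continuum bare integral of the interpolant (`D = 1`, no weight comparison) plus edge-difference energy with the
constant `|T|/16·sup_T‖W‖`.  Ingredients: the pointwise variance identity (part 23), `λ_m ≥ 0` on the cell, `∫_T λ_mλ_{m'} ≤ |T|/16` (part 22).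
NOT a proof of H12⋆, NOT summit progress.  [folklore]
-/

noncomputable section

open Set Function Metric MeasureTheory Filter Topology
open scoped BigOperators NNReal ENNReal

namespace Summit.AtomisticToContinuum.Crystallization.Theorems.StrictSplittingRuleBirth

/-- The hat functions are nonnegative on their cell. -/
theorem p1Lam_nonneg_of_mem {a h : ℝ} {i : (ℤ × ℤ × ℤ) × Fin 6} {y : Fin 3 → ℝ} (hy : y ∈ p1RealCell a h i) (m : Fin 4) :
    0 ≤ p1Lam a h i m y :=
  hy m

/-- Continuity in `x` of `x ↦ q_{W(x)}(u(x))` for continuous weight entries and continuous arguments. -/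
theorem continuous_p1Quad3_of_continuous {W : (Fin 3 → ℝ) → Fin 3 → Fin 3 → ℝ} (hWc : ∀ k l, Continuous fun x => W x k l)
    {u : (Fin 3 → ℝ) → Fin 3 → ℝ} (hu : ∀ k, Continuous fun x => u x k) : Continuous fun x => p1Quad3 (W x) (u x) := by
  simp only [p1Quad3_eq]
  have := hWc 0 0; have := hWc 0 1; have := hWc 0 2; have := hWc 1 0; have := hWc 1 1; have := hWc 1 2
  have := hWc 2 0; have := hWc 2 1; have := hWc 2 2; have := hu 0; have := hu 1; have := hu 2
  fun_prop

/-- **THE VERTEX-QUADRATURE EXCESS WITH A VARIABLE WEIGHT** (`0 ⪯ W(x)`, `q_{W(x)}(u) ≤ w_T|u|²` on the cell):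
`Σ_m ∫_T λ_m·q_{W}(v_m) ≤ ∫_T q_W(ṽ) + (√3a²h/192)·w_T·½Σ_mΣ_{m'}|v_m − v_{m'}|²`.  NOT a proof of H12⋆, NOT summit progress. -/
theorem vertex_quadrature_excess_var_p1RealCell {a h : ℝ} (ha : 0 < a) (hh : 0 < h) (i : (ℤ × ℤ × ℤ) × Fin 6)
    (W : (Fin 3 → ℝ) → Fin 3 → Fin 3 → ℝ) (hWc : ∀ k l, Continuous fun x => W x k l)
    (hW0 : ∀ y ∈ p1RealCell a h i, ∀ u : Fin 3 → ℝ, 0 ≤ p1Quad3 (W y) u) {wT : ℝ}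
    (hwT : ∀ y ∈ p1RealCell a h i, ∀ u : Fin 3 → ℝ, p1Quad3 (W y) u ≤ wT * (u 0 ^ 2 + u 1 ^ 2 + u 2 ^ 2)) (v : Fin 4 → Fin 3 → ℝ) :
    ∑ m, ∫ y in p1RealCell a h i, p1Lam a h i m y * p1Quad3 (W y) (v m) ≤
      (∫ y in p1RealCell a h i, p1Quad3 (W y) (fun k => ∑ m, p1Lam a h i m y * v m k)) +
        √3 * a ^ 2 * h / 192 * wT * (1 / 2 * ∑ m, ∑ m', ((v m 0 - v m' 0) ^ 2 + (v m 1 - v m' 1) ^ 2 + (v m 2 - v m' 2) ^ 2)) := by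
  have hK := isCompact_p1RealCell ha.ne' hh.ne' i
  have hmeas : MeasurableSet (p1RealCell a h i) := (isClosed_p1RealCell a h i).measurableSet
  have hcl : ∀ m, Continuous (p1Lam a h i m) := continuous_p1Lam a h i
  have hq : ∀ u : Fin 3 → ℝ, Continuous fun y => p1Quad3 (W y) u := fun u =>
    continuous_p1Quad3_of_continuous hWc (u := fun _ => u) fun k => continuous_const
  -- integrability
  have iA : ∀ m, IntegrableOn (fun y => p1Lam a h i m y * p1Quad3 (W y) (v m)) (p1RealCell a h i) volume := fun m =>
    ((hcl m).mul (hq _)).continuousOn.integrableOn_compact hK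
  have iB : ∀ m m', IntegrableOn (fun y => p1Lam a h i m y * p1Lam a h i m' y * p1Quad3 (W y) (v m - v m')) (p1RealCell a h i) volume :=
    fun m m' => (((hcl m).mul (hcl m')).mul (hq _)).continuousOn.integrableOn_compact hK
  have iB' : ∀ m m', IntegrableOn (fun y => p1Lam a h i m y * p1Lam a h i m' y *
      (wT * ((v m 0 - v m' 0) ^ 2 + (v m 1 - v m' 1) ^ 2 + (v m 2 - v m' 2) ^ 2))) (p1RealCell a h i) volume :=
    fun m m' => (((hcl m).mul (hcl m')).mul continuous_const).continuousOn.integrableOn_compact hK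
  have iQ : IntegrableOn (fun y => p1Quad3 (W y) (fun k => ∑ m, p1Lam a h i m y * v m k)) (p1RealCell a h i) volume := by
    have : Continuous fun y => p1Quad3 (W y) (fun k => ∑ m, p1Lam a h i m y * v m k) := by
      refine continuous_p1Quad3_of_continuous hWc fun k => ?_
      simp only [Fin.sum_univ_four]
      fun_prop
    exact this.continuousOn.integrableOn_compact hK
  have iS : IntegrableOn (fun y => ∑ m, p1Lam a h i m y * p1Quad3 (W y) (v m)) (p1RealCell a h i) volume :=
    integrable_finsetSum _ fun m _ => iA m
  have iD : IntegrableOn (fun y => 1 / 2 * ∑ m, ∑ m', p1Lam a h i m y * p1Lam a h i m' y * p1Quad3 (W y) (v m - v m'))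
      (p1RealCell a h i) volume :=
    (integrable_finsetSum _ fun m _ => integrable_finsetSum _ fun m' _ => iB m m').const_mul _
  have iD' : IntegrableOn (fun y => 1 / 2 * ∑ m, ∑ m', p1Lam a h i m y * p1Lam a h i m' y *
      (wT * ((v m 0 - v m' 0) ^ 2 + (v m 1 - v m' 1) ^ 2 + (v m 2 - v m' 2) ^ 2))) (p1RealCell a h i) volume :=
    (integrable_finsetSum _ fun m _ => integrable_finsetSum _ fun m' _ => iB' m m').const_mul _
  -- pointwise variance identity
  have hpt : ∀ y, (∑ m, p1Lam a h i m y * p1Quad3 (W y) (v m)) - p1Quad3 (W y) (fun k => ∑ m, p1Lam a h i m y * v m k) =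
      1 / 2 * ∑ m, ∑ m', p1Lam a h i m y * p1Lam a h i m' y * p1Quad3 (W y) (v m - v m') :=
    fun y => p1_variance_identity (W y) (fun m => p1Lam a h i m y) (sum_p1Lam_eq_one a h i y) v
  -- the defect, pointwise dominated on the cell
  have hdom : ∀ y ∈ p1RealCell a h i, 1 / 2 * ∑ m, ∑ m', p1Lam a h i m y * p1Lam a h i m' y * p1Quad3 (W y) (v m - v m') ≤
      1 / 2 * ∑ m, ∑ m', p1Lam a h i m y * p1Lam a h i m' y * (wT * ((v m 0 - v m' 0) ^ 2 + (v m 1 - v m' 1) ^ 2 + (v m 2 - v m' 2) ^ 2)) := by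
    intro y hy
    refine mul_le_mul_of_nonneg_left (Finset.sum_le_sum fun m _ => Finset.sum_le_sum fun m' _ => ?_) (by norm_num)
    have hl := mul_nonneg (p1Lam_nonneg_of_mem hy m) (p1Lam_nonneg_of_mem hy m')
    have hb := hwT y hy (v m - v m')
    simp only [Pi.sub_apply] at hb
    exact mul_le_mul_of_nonneg_left hb hl
  -- integrate the dominated defect
  have hD : ∫ y in p1RealCell a h i, 1 / 2 * ∑ m, ∑ m', p1Lam a h i m y * p1Lam a h i m' y * p1Quad3 (W y) (v m - v m') ≤
      √3 * a ^ 2 * h / 192 * wT * (1 / 2 * ∑ m, ∑ m', ((v m 0 - v m' 0) ^ 2 + (v m 1 - v m' 1) ^ 2 + (v m 2 - v m' 2) ^ 2)) := by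
    refine (setIntegral_mono_on iD iD' hmeas hdom).trans ?_
    rw [integral_const_mul, integral_finsetSum _ fun m _ => integrable_finsetSum _ fun m' _ => iB' m m']
    have hB' : ∑ m, ∫ y in p1RealCell a h i, ∑ m', p1Lam a h i m y * p1Lam a h i m' y *
        (wT * ((v m 0 - v m' 0) ^ 2 + (v m 1 - v m' 1) ^ 2 + (v m 2 - v m' 2) ^ 2)) ≤
        ∑ m : Fin 4, ∑ m' : Fin 4, √3 * a ^ 2 * h / 192 * (wT * ((v m 0 - v m' 0) ^ 2 + (v m 1 - v m' 1) ^ 2 + (v m 2 - v m' 2) ^ 2)) := by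
      refine Finset.sum_le_sum fun m _ => ?_
      rw [integral_finsetSum _ fun m' _ => iB' m m']
      refine Finset.sum_le_sum fun m' _ => ?_
      rw [integral_mul_const]
      by_cases hmm : m = m'
      · subst hmm
        simp
      · have hwT0 : 0 ≤ wT * ((v m 0 - v m' 0) ^ 2 + (v m 1 - v m' 1) ^ 2 + (v m 2 - v m' 2) ^ 2) := by
          obtain ⟨y, hy⟩ : (p1RealCell a h i).Nonempty := ⟨_, p1Chart_vert_mem_p1RealCell ha.ne' hh.ne' i 0⟩
          have h0 := hW0 y hy (v m - v m')
          have h1 := hwT y hy (v m - v m')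
          simp only [Pi.sub_apply] at h0 h1
          linarith
        exact mul_le_mul_of_nonneg_right (setIntegral_p1Lam_mul_le ha hh i hmm) hwT0
    have e : ∑ m : Fin 4, ∑ m' : Fin 4, √3 * a ^ 2 * h / 192 * (wT * ((v m 0 - v m' 0) ^ 2 + (v m 1 - v m' 1) ^ 2 + (v m 2 - v m' 2) ^ 2)) =
        √3 * a ^ 2 * h / 192 * wT * ∑ m : Fin 4, ∑ m' : Fin 4, ((v m 0 - v m' 0) ^ 2 + (v m 1 - v m' 1) ^ 2 + (v m 2 - v m' 2) ^ 2) := by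
      simp_rw [Finset.mul_sum]
      refine Finset.sum_congr rfl fun m _ => Finset.sum_congr rfl fun m' _ => by ring
    nlinarith [hB', e]
  have hdiff : (∫ y in p1RealCell a h i, ∑ m, p1Lam a h i m y * p1Quad3 (W y) (v m)) -
      ∫ y in p1RealCell a h i, p1Quad3 (W y) (fun k => ∑ m, p1Lam a h i m y * v m k) =
      ∫ y in p1RealCell a h i, 1 / 2 * ∑ m, ∑ m', p1Lam a h i m y * p1Lam a h i m' y * p1Quad3 (W y) (v m - v m') := by
    rw [← integral_sub iS iQ]
    exact setIntegral_congr_fun hmeas fun y _ => hpt y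
  rw [← integral_finsetSum _ fun m _ => iA m]
  linarith [hD, hdiff]

end Summit.AtomisticToContinuum.Crystallization.Theorems.StrictSplittingRuleBirth
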